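import Literature.MathematicalPhysics.QuantumFieldTheory.Balaban1983to89.B9

/-!
# `Balaban1983to89.B9TracePairingMatrix` — [Balaban1985BackgroundPropagators] pp. 391–392 «The inner product for these matrices is defined by X·Y = tr XY»:
# the four properties of print's trace pairing on the MATRIX FIBRE `M_N(ℂ)` that the `ℤᵈ`-carrier Landau files take as displayed hypotheses on a trace
# parameter `τ : 𝔸 →ₗ[ℂ] ℂ` — tracial, Hermitian, faithful, non-degenerate — proved for `τ = Matrix.traceLinearMap (Fin N) ℂ ℂ` with NO norm structure
# (so they plug into `B9Eq321LandauOrthogonalZd ∕ …ProjectionZd ∕ …MultiplierIffZd ∕ B9Eq326GaugeTermSquareZd` under whatever `CStarAlgebra` instance the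
# consumer puts on the matrices)

statement-level skeleton of published theorems with citation tags; proofs where landed; nothing here is a claim about the
Yang–Mills mass gap

`[Balaban1985BackgroundPropagators]` ("B9", CMP **99** (1985) 389–434) pp. 391–392: *«The adjoints are taken with respect to natural L² scalar products for
functions with values in N × N hermitian matrices. The inner product for these matrices is defined by X·Y = tr XY»*; p. 390: *«|X| of a N × N matrix means
the Hilbert–Schmidt norm, i.e. |X|² = tr X*X»*; p. 393 (3.17) (the scalar product `⟨λ, λ′⟩ = Σ η^d tr λ(x)λ′(x)`).

CITATION HEADER (lean-in-tree rule).  Cell `pub-ymgap`, DAG node N06 = [B9], width seat `pub-ymgap-dag-n06-w4` (g0).  WHY: the seat's Landau files at the `ℤᵈ`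
carrier (`B9Eq321LandauOrthogonalZd` p584388, `B9Eq321LandauProjectionZd` p585863, `B9Eq321LandauNonVacuityZd` p588891, `B9Eq321LandauMultiplierIffZd`
p589686, `B9Eq326GaugeTermSquareZd`) keep the fibre `𝔸` abstract and carry print's trace as a PARAMETER `τ : 𝔸 →ₗ[ℂ] ℂ` with displayed properties —
`hτt` tracial `τ(ab) = τ(ba)`, `hτs` Hermitian `τ(a*) = conj τ(a)`, `hτp` faithful `Re τ(a*a) > 0` for `a ≠ 0`, `hτn` non-degenerate `(∀ b, τ(ab) = 0) → a = 0`
— discharged in-file only for the abelian fibre `ℂ`.  THIS FILE discharges all four for the cell's model fibre `M_N(ℂ)` (`Node00.Record11.MatA N`,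
`B7Prop2Explicit` §6) with `τ = Matrix.traceLinearMap (Fin N) ℂ ℂ` (print's `tr`; the normalisation `tr 1 = 1` of p. 392 is a positive factor and
changes none of the four), by entrywise identities only — no norm, no order on `ℂ`, no instance.

WHAT IS PROVED (kernel, 0 sorry; theorems only).  `matrixTrace_tracial` (`Matrix.trace_mul_comm`), `matrixTrace_star` (`Matrix.trace_conjTranspose`),
`re_matrixTrace_conjTranspose_mul_self` (`Re tr(A*A) = Σ_{i,j} |A_{ij}|²` — the Hilbert–Schmidt norm squared of p. 390), ★ `matrixTrace_faithful`,
★ `matrixTrace_nondegenerate`.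

HONEST SCOPE.  Linear algebra of the fibre; nothing of [B9]'s analysis; count-neutral; N05 ∕ N06 NOT discharged; one finite `𝕋⁴` programme at fixed `ε`, Bałaban
as printed; R4 closes only the conditional finite-`𝕋⁴` rung `BalabanLadder.UV` — nothing continuum ∕ ℝ⁴ ∕ OS ∕ mass gap ∕ Clay.  Unit `pub-ymgap-dag-n06-w4`
(g0), 2026-08-28.
-/

namespace Literature.MathematicalPhysics.QuantumFieldTheory.Balaban1983to89.B9TracePairingMatrix

open Matrix

variable (N : ℕ)

/-- **print's `tr` is TRACIAL**: `tr(XY) = tr(YX)`. [cite: Balaban1985BackgroundPropagators, p.391 («X·Y = tr XY»)] -/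
theorem matrixTrace_tracial (a b : Matrix (Fin N) (Fin N) ℂ) :
    Matrix.traceLinearMap (Fin N) ℂ ℂ (a * b) = Matrix.traceLinearMap (Fin N) ℂ ℂ (b * a) := by
  simp only [Matrix.traceLinearMap_apply]
  exact Matrix.trace_mul_comm a b

/-- **print's `tr` is HERMITIAN**: `tr(X*) = conj (tr X)` (`*` = conjugate transpose). [cite: Balaban1985BackgroundPropagators, p.390 («|X|² = tr X*X»), p.391] -/
theorem matrixTrace_star (a : Matrix (Fin N) (Fin N) ℂ) :
    Matrix.traceLinearMap (Fin N) ℂ ℂ (star a) = starRingEnd ℂ (Matrix.traceLinearMap (Fin N) ℂ ℂ a) := by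
  simp only [Matrix.traceLinearMap_apply, Matrix.star_eq_conjTranspose, Matrix.trace_conjTranspose, Complex.star_def]

/-- **THE HILBERT–SCHMIDT NORM SQUARED** (p. 390 «|X|² = tr X*X»): `Re tr(A*A) = Σ_{i,j} |A_{ij}|²`, entrywise. [cite: Balaban1985BackgroundPropagators, p.390 («|X|² = tr X*X»)] -/
theorem re_matrixTrace_conjTranspose_mul_self (a : Matrix (Fin N) (Fin N) ℂ) :
    (Matrix.traceLinearMap (Fin N) ℂ ℂ (star a * a)).re = ∑ i : Fin N, ∑ j : Fin N, Complex.normSq (a j i) := by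
  simp only [Matrix.traceLinearMap_apply, Matrix.trace, Matrix.diag_apply, Matrix.mul_apply, Matrix.star_apply,
    Complex.re_sum]
  refine Finset.sum_congr rfl fun i _ => Finset.sum_congr rfl fun j _ => ?_
  rw [Complex.star_def, mul_comm, Complex.mul_conj, Complex.ofReal_re]

/-- ★ **print's `tr` is FAITHFUL**: `Re tr(A*A) > 0` for `A ≠ 0` (some entry has `|A_{ij}|² > 0`). [cite: Balaban1985BackgroundPropagators, p.390 («|X|² = tr X*X»), p.391] -/
theorem matrixTrace_faithful (a : Matrix (Fin N) (Fin N) ℂ) (ha : a ≠ 0) :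
    0 < (Matrix.traceLinearMap (Fin N) ℂ ℂ (star a * a)).re := by
  rw [re_matrixTrace_conjTranspose_mul_self]
  -- a non-zero entry
  obtain ⟨j, i, hji⟩ : ∃ j i, a j i ≠ 0 := by
    by_contra h
    simp only [not_exists, not_not] at h
    exact ha (Matrix.ext fun j i => h j i)
  have hle : Complex.normSq (a j i) ≤ ∑ i : Fin N, ∑ j : Fin N, Complex.normSq (a j i) := by
    have h1 : Complex.normSq (a j i) ≤ ∑ j' : Fin N, Complex.normSq (a j' i) :=
      Finset.single_le_sum (f := fun j' => Complex.normSq (a j' i)) (fun j' _ => Complex.normSq_nonneg _) (Finset.mem_univ j)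
    exact h1.trans (Finset.single_le_sum (f := fun i' => ∑ j' : Fin N, Complex.normSq (a j' i'))
      (fun i' _ => Finset.sum_nonneg fun j' _ => Complex.normSq_nonneg _) (Finset.mem_univ i))
  exact lt_of_lt_of_le (Complex.normSq_pos.2 hji) hle

/-- ★ **print's `tr` PAIRING IS NON-DEGENERATE**: if `tr(AB) = 0` for every `B` then `A = 0` (test `B = A*`: `Re tr(AA*) = Re tr(A* A)` by traciality, then
faithfulness). [cite: Balaban1985BackgroundPropagators, p.391 («X·Y = tr XY»)] -/
theorem matrixTrace_nondegenerate (a : Matrix (Fin N) (Fin N) ℂ) (h : ∀ b : Matrix (Fin N) (Fin N) ℂ, Matrix.traceLinearMap (Fin N) ℂ ℂ (a * b) = 0) :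
    a = 0 := by
  by_contra ha
  have h1 := h (star a)
  rw [matrixTrace_tracial] at h1
  have h2 := matrixTrace_faithful N a ha
  rw [h1, Complex.zero_re] at h2
  exact lt_irrefl _ h2

end Literature.MathematicalPhysics.QuantumFieldTheory.Balaban1983to89.B9TracePairingMatrix
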